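import Summits.BirchSwinnertonDyer.Rank1Residual.GaloisImage.KolyvaginDerivativeLocalImageRat
import Summits.BirchSwinnertonDyer.Rank1Residual.GaloisImage.TorsionPadicIntCoefficientsLocal
import Mathlib.Data.Nat.GCD.BigOperators
import HarnessLib

/-!
# THEOREM D's local clause at an ANOMALOUS bad place: `loc_w κ_r ∈ 𝓕_can,w` when `p ∤ ord(w mod n(r))`
# (cell `b2b-bsdres`, team n1011; row T-DER-D4BN (proposed), file F1; seat p15 GEN 9 — composes the
# seat's T-DER-BN ℚ END (GEN 6, p308679) with n1011-p13's GZ-4 (`TorsionPadicIntCoefficientsLocal`))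

HONEST FRAMING (cell `b2b-bsdres`, run/shared/lean/b2b/bsd-rank1-residual/, verbatim in every
file): the goal of the cell is to DELETE the COMBINATION-SHAPED residual classes of the
Birch–Swinnerton-Dyer formula for ALL analytic-rank `≤ 1` elliptic curves over `ℚ` — "full BSD
formula for every rank `≤ 1` curve in class `C`" assembled STRICTLY from published theorems — so
that the rank-`≤ 1` remainder becomes exactly the CONSTRUCTION-SHAPED classes, which are TYPED
(missing-input `Prop`s), NOT attempted. This is not "finishing BSD". Team n1011 (N10/N11; route-1
PORT, (P-DER) clause C1/C0): research route on the CONSTRUCTION-SHAPED class X4; TOOL theorems;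
nothing booked; no mark / label / count moved. No definition, no named fact, no `sorry`.

## What

n1011-p11's THEOREM D (`KolyvaginSystemOfEulerSystemPropagated`, D4) serves the rows on which
`E(ℚ_w)[p] = 0` at every bad `w ≠ p` — there `H¹(ℚ_w, E[p^{k+1}]) = 0` and the local clause of a
Kolyvagin system is vacuous (F10). At an ANOMALOUS bad place (`E(ℚ_w)[p] ≠ 0`; on the N11 table
74 % of the rows have one: n1011-p15 GEN 7 census, kit j143811) Mazur–Rubin's propagated condition
`𝓕_can,w = im(H¹(ℚ_w, T_pE) → H¹(ℚ_w, E[p^{k+1}]))` is a proper subgroup, and membership of the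
derivative class needs the CLASS-LEVEL argument of row T-DER-BN: `res_{ℚ(μ_r)} κ_r = D_r red_* c_r`
comes from `H¹(ℚ(μ_r), T_pE)`, and `cor ∘ res = [ℚ_w(μ_r) : ℚ_w] = ord(w mod n(r))` is invertible on
the `p`-power-torsion cokernel as soon as `p ∤ ord(w mod n(r))`
(`Derivative.Rat.exists_map_red_eq_localization_of_not_dvd_orderOf`). This file composes that END
with GZ-4 (`TorsionCoeff.localization_mem_propagatedSelmerStructure_of_map_red_eq`):

* `Rat.localization_mem_propagatedSelmerStructure_of_res_eq_deriv_of_not_dvd_orderOf` — for a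
  coefficient representation `T′` of `Γ_ℚ` with `red : T_pE ⟶ T′` and an equivariant continuous
  additive `e : T′ → E[p^k·p]` with `π_{k+1} = e ∘ red` (`hcomp`, GZ-4's pin), the global transport
  `Φ` computed on cocycles by `e` (GZ-1), a level `r`, generators `σ`, exponents `N`, and a class
  `κ ∈ H¹_cont(Γ_ℚ, T′)` with `res_{U_r} κ = D_r (red_* c_{⊥,r})`: at every finite place `w ∉ r`
  with `p ∤ orderOf (w : ZMod (∏_{q ∈ r} q))`, **`loc_w (Φ κ) ∈ propagatedSelmerStructure W p k (inr w)`**;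
* `exists_dvd_orderOf_of_dvd_orderOf_prod` (+ `orderOf_natCast_zmod_mul_eq_lcm`,
  `prime_dvd_lcm_iff`) — the order of `w` modulo a product of distinct primes is controlled prime by
  prime (CRT: it is the `lcm`), so the hypothesis follows from **`p ∤ orderOf (w : ZMod q)` for every
  `q ∈ r`** (`…_of_forall_not_dvd_orderOf`): the prime set `𝒫″` of ROUTE-1 §43.5 (a) restricted to
  the anomalous places.

HONEST LIMITS: no Euler system asserted (`c` is ANY family); nothing at the place `p`; no
certificate that a given Kolyvagin prime lies in `𝒫″`; closes nothing by itself.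

References: K. Rubin, *Euler Systems* (2000) Thm. 4.5.1; B. Mazur, K. Rubin, Mem. AMS 799 (2004)
Def. 3.2.1, Thm. 3.2.4, App. A Prop. A.2; K. Rubin, PCMI 18 (2011) §3.1.
-/

noncomputable section

open CategoryTheory Function Finset Field IsDedekindDomain NumberField
open scoped NumberField Classical
open Literature.NumberTheory.GaloisRepresentations Literature.NumberTheory.EllipticCurves

universe u

namespace Summit.BirchSwinnertonDyer.Rank1Residual.GaloisImage

namespace Derivative

/-! ### §1 Orders modulo a squarefree product -/

section Orders

/-- `ord_{mn}(x) = lcm (ord_m x) (ord_n x)` for coprime `m, n` (Chinese remainder theorem).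
[folklore] -/
theorem orderOf_natCast_zmod_mul_eq_lcm {m n : ℕ} (h : m.Coprime n) (x : ℕ) :
    orderOf ((x : ZMod (m * n))) = Nat.lcm (orderOf (x : ZMod m)) (orderOf (x : ZMod n)) := by
  have e := ZMod.chineseRemainder h
  have hinj : Function.Injective (e.toRingHom.toMonoidHom) := e.injective
  rw [← orderOf_injective e.toRingHom.toMonoidHom hinj (x : ZMod (m * n))]
  have h1 : e.toRingHom.toMonoidHom (x : ZMod (m * n)) = ((x : ZMod m), (x : ZMod n)) := by
    change e (x : ZMod (m * n)) = _
    rw [map_natCast]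
    rfl
  rw [h1, Prod.orderOf]

/-- A prime divides `lcm a b` (`a, b ≠ 0`) iff it divides `a` or `b`. [folklore] -/
theorem prime_dvd_lcm_iff {p a b : ℕ} (hp : p.Prime) (_ha : a ≠ 0) (_hb : b ≠ 0) :
    p ∣ Nat.lcm a b ↔ p ∣ a ∨ p ∣ b := by
  constructor
  · intro h
    exact hp.dvd_mul.mp (h.trans (Nat.lcm_dvd_mul a b))
  · rintro (h | h)
    · exact h.trans (Nat.dvd_lcm_left a b)
    · exact h.trans (Nat.dvd_lcm_right a b)

/-- For a finite family `f` of pairwise distinct primes indexed by `s` and a prime `p`: if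
`p ∣ ord_{∏_{i∈s} f i}(x)` then `p ∣ ord_{f i}(x)` for some `i ∈ s` (non-units have order `0`,
divisible by everything, so no coprimality hypothesis on `x` is needed). [folklore] -/
theorem exists_dvd_orderOf_of_dvd_orderOf_prod {ι : Type*} {p : ℕ} (hp : p.Prime) (s : Finset ι)
    (f : ι → ℕ) (hs : ∀ i ∈ s, (f i).Prime) (hinj : ∀ i ∈ s, ∀ j ∈ s, f i = f j → i = j) (x : ℕ)
    (h : p ∣ orderOf ((x : ZMod (∏ i ∈ s, f i)))) : ∃ i ∈ s, p ∣ orderOf ((x : ZMod (f i))) := by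
  classical
  induction s using Finset.induction_on with
  | empty =>
    exfalso
    rw [Finset.prod_empty] at h
    have h1 : orderOf ((x : ZMod 1)) = 1 := by
      rw [Subsingleton.elim (x : ZMod 1) 1, orderOf_one]
    rw [h1, Nat.dvd_one] at h
    exact hp.one_lt.ne' h
  | insert i s hi ih =>
    rw [Finset.prod_insert hi] at h
    have hcop : (f i).Coprime (∏ j ∈ s, f j) := by
      refine Nat.Coprime.prod_right fun j hj => ?_
      have hne : f i ≠ f j := fun hij =>
        hi ((hinj i (Finset.mem_insert_self i s) j (Finset.mem_insert_of_mem hj) hij) ▸ hj)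
      exact (Nat.coprime_primes (hs i (Finset.mem_insert_self i s))
        (hs j (Finset.mem_insert_of_mem hj))).mpr hne
    rw [orderOf_natCast_zmod_mul_eq_lcm hcop] at h
    have hs' : ∀ j ∈ s, (f j).Prime := fun j hj => hs j (Finset.mem_insert_of_mem hj)
    have hinj' : ∀ j ∈ s, ∀ j' ∈ s, f j = f j' → j = j' := fun j hj j' hj' =>
      hinj j (Finset.mem_insert_of_mem hj) j' (Finset.mem_insert_of_mem hj')
    rcases Nat.eq_zero_or_pos (orderOf ((x : ZMod (f i)))) with h0 | hpos
    · exact ⟨i, Finset.mem_insert_self i s, h0 ▸ dvd_zero p⟩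
    rcases Nat.eq_zero_or_pos (orderOf ((x : ZMod (∏ j ∈ s, f j)))) with h0' | hpos'
    · obtain ⟨j, hj, hdvd⟩ := ih hs' hinj' (h0' ▸ dvd_zero p)
      exact ⟨j, Finset.mem_insert_of_mem hj, hdvd⟩
    rcases (prime_dvd_lcm_iff hp hpos.ne' hpos'.ne').mp h with h' | h'
    · exact ⟨i, Finset.mem_insert_self i s, h'⟩
    · obtain ⟨j, hj, hdvd⟩ := ih hs' hinj' h'
      exact ⟨j, Finset.mem_insert_of_mem hj, hdvd⟩

open Rat.HeightOneSpectrum in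
/-- The order of `w` modulo `n(r) = ∏_{q ∈ r} q` (a product of DISTINCT rational primes indexed by
finite places) is prime to `p` as soon as `p ∤ ord(w mod q)` for every `q ∈ r`. [folklore] -/
theorem not_dvd_orderOf_prod_of_forall {p : ℕ} (hp : p.Prime) (r : Finset (HeightOneSpectrum (𝓞 ℚ)))
    (w : ℕ) (h : ∀ q ∈ r, ¬ p ∣ orderOf ((w : ZMod ((primesEquiv q : Nat.Primes) : ℕ)))) :
    ¬ p ∣ orderOf ((w : ZMod (∏ q ∈ r, ((primesEquiv q : Nat.Primes) : ℕ)))) := by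
  intro hdvd
  obtain ⟨q, hq, hpq⟩ := exists_dvd_orderOf_of_dvd_orderOf_prod hp r
    (fun q => ((primesEquiv q : Nat.Primes) : ℕ)) (fun q _ => (primesEquiv q).2)
    (fun q₁ _ q₂ _ heq => primesEquiv.injective (Subtype.ext heq)) w hdvd
  exact h q hq hpq

end Orders

/-! ### §2 The local clause at a place of prime-to-`p` degree: T-DER-BN ∘ GZ-4 -/

section LocalClause

open Rat.HeightOneSpectrum

variable (W : WeierstrassCurve ℚ) [W.IsElliptic] (p : ℕ) [Fact p.Prime] (k : ℕ)
variable [ContinuousSMul ℤ_[p] (W.tateModule p)]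
variable {S : Set (HeightOneSpectrum (𝓞 ℚ))}
variable {c : ∀ (i : ℕ) (r : (cyclotomicLevelsRat p S).Ideals),
  H1 (W.tateGaloisRep p (W.continuous_galoisRepTate_holds p)) ((cyclotomicLevelsRat p S).level i r.1)}
variable {M' : Type} [AddCommGroup M'] [Module ℤ_[p] M'] [TopologicalSpace M']
  [IsTopologicalAddGroup M'] [ContinuousSMul ℤ_[p] M'] {T' : GaloisRep ℚ ℤ_[p] M'}

/-- **THEOREM D's local clause at a place `w ∉ r` of prime-to-`p` degree in `ℚ(μ_r)`** (bad
places of `E`, anomalous or not, included; `w = p` allowed): for `red : T_pE ⟶ T′`, an additive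
continuous equivariant `e : T′ → E[p^k·p]` with `π_{k+1} = e ∘ red` (`hcomp`), the global transport
`Φ` computed on cocycles by `e`, and `κ ∈ H¹_cont(Γ_ℚ, T′)` with
`res_{U_r} κ = D_r (red_* c_{⊥,r})` for ANY family `c` on the cyclotomic levels: if
`p ∤ orderOf (w : ZMod (∏_{q∈r} q))` then `loc_w (Φ κ) ∈ 𝓕_can,w = propagatedSelmerStructure W p k (inr w)`.
Proof: T-DER-BN's `Derivative.Rat.exists_map_red_eq_localization_of_not_dvd_orderOf` gives
`z′ ∈ H¹(ℚ_w, T_pE)` with `red_* z′ = res_w^* κ`; GZ-4's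
`TorsionCoeff.localization_mem_propagatedSelmerStructure_of_map_red_eq` reads it in `𝓕_can`.
[cite: Rubin2000, Thm. 4.5.1] [cite: MazurRubin2004, Def. 3.2.1 and Thm. 3.2.4] -/
theorem Rat.localization_mem_propagatedSelmerStructure_of_res_eq_deriv_of_not_dvd_orderOf
    (red : (W.tateGaloisRep p (W.continuous_galoisRepTate_holds p)).toTopRep ⟶ T'.toTopRep)
    (e : M' →+ WeierstrassCurve.geomTorsion W ((p : ℤ) ^ k * (p : ℤ))) (hec : Continuous e)
    (he : ∀ (g : absoluteGaloisGroup ℚ) (x : M'),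
      e (T' g x) = W.torsionGaloisModule ((p : ℤ) ^ k * (p : ℤ)) g (e x))
    (hcomp : ∀ a : W.tateModule p, tateToTorsion W p k a = e (red.hom a))
    (Φ : continuousCohomology 1 T'.toTopRep →+
      galoisCohomology (W.torsionGaloisModule ((p : ℤ) ^ k * (p : ℤ))) 1)
    (hΦ : ∀ (φ : contOneCocycles T'.toTopRep)
      (ψ : contOneCocycles (W.torsionGaloisModule ((p : ℤ) ^ k * (p : ℤ))).toTopRep),
      (∀ g, ψ.1 g = e (φ.1 g)) → Φ (oneCocycleClass _ φ) = oneCocycleClass _ ψ)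
    (r : (cyclotomicLevelsRat p S).Ideals) (σ : HeightOneSpectrum (𝓞 ℚ) → absoluteGaloisGroup ℚ)
    (N : HeightOneSpectrum (𝓞 ℚ) → ℕ) (comm) (κ : continuousCohomology 1 T'.toTopRep)
    (hκ : resSubgroup T'.toTopRep ((cyclotomicLevelsRat p S).level ⊥ r.1) 1 κ =
        (r.1.noncommProd (fun ℓ => ∑ j ∈ range (N ℓ), (j : Module.End ℤ_[p] (continuousCohomology 1
          (subgroupRep T'.toTopRep ((cyclotomicLevelsRat p S).level ⊥ r.1)))) *
          (conjMap T'.toTopRep ((cyclotomicLevelsRat p S).level ⊥ r.1) (σ ℓ) 1).hom.toLinearMap ^ j) comm)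
        (ContinuousCohomology.map (ContinuousMonoidHom.id _)
          (X := subgroupRep (W.tateGaloisRep p (W.continuous_galoisRepTate_holds p)).toTopRep
            ((cyclotomicLevelsRat p S).level ⊥ r.1))
          (Y := subgroupRep T'.toTopRep ((cyclotomicLevelsRat p S).level ⊥ r.1))
          ((TopRep.resFunctor ((cyclotomicLevelsRat p S).level ⊥ r.1).subtype).map red) 1 (c ⊥ r)))
    (w : HeightOneSpectrum (𝓞 ℚ)) (hw : ∀ q ∈ r.1, q ≠ w)
    (hord : ¬ p ∣ orderOf ((((primesEquiv w : Nat.Primes) : ℕ) :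
      ZMod (∏ q ∈ r.1, ((primesEquiv q : Nat.Primes) : ℕ))))) :
    galoisCohomology.localization (W.torsionGaloisModule ((p : ℤ) ^ k * (p : ℤ))) (Sum.inr w) 1 (Φ κ) ∈
      propagatedSelmerStructure W p k (Sum.inr w) := by
  obtain ⟨z', hz'⟩ := Rat.exists_map_red_eq_localization_of_not_dvd_orderOf red r σ N comm κ hκ w hw hord
  exact TorsionCoeff.localization_mem_propagatedSelmerStructure_of_map_red_eq W p k red e hec he hcomp
    Φ hΦ w κ z' hz'

/-- **The same under the prime-by-prime hypothesis** `p ∤ ord(w mod q)` for every `q ∈ r` — the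
prime set `𝒫″` of ROUTE-1 §43.5 (a) restricted to the place `w` (at an anomalous bad `w` this is the
condition a Kolyvagin prime must satisfy; at a non-anomalous bad `w` the clause is vacuous, F10).
[cite: Rubin2000, Thm. 4.5.1] [cite: MazurRubin2004, Def. 3.2.1 and Thm. 3.2.4] -/
theorem Rat.localization_mem_propagatedSelmerStructure_of_res_eq_deriv_of_forall_not_dvd_orderOf
    (red : (W.tateGaloisRep p (W.continuous_galoisRepTate_holds p)).toTopRep ⟶ T'.toTopRep)
    (e : M' →+ WeierstrassCurve.geomTorsion W ((p : ℤ) ^ k * (p : ℤ))) (hec : Continuous e)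
    (he : ∀ (g : absoluteGaloisGroup ℚ) (x : M'),
      e (T' g x) = W.torsionGaloisModule ((p : ℤ) ^ k * (p : ℤ)) g (e x))
    (hcomp : ∀ a : W.tateModule p, tateToTorsion W p k a = e (red.hom a))
    (Φ : continuousCohomology 1 T'.toTopRep →+
      galoisCohomology (W.torsionGaloisModule ((p : ℤ) ^ k * (p : ℤ))) 1)
    (hΦ : ∀ (φ : contOneCocycles T'.toTopRep)
      (ψ : contOneCocycles (W.torsionGaloisModule ((p : ℤ) ^ k * (p : ℤ))).toTopRep),
      (∀ g, ψ.1 g = e (φ.1 g)) → Φ (oneCocycleClass _ φ) = oneCocycleClass _ ψ)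
    (r : (cyclotomicLevelsRat p S).Ideals) (σ : HeightOneSpectrum (𝓞 ℚ) → absoluteGaloisGroup ℚ)
    (N : HeightOneSpectrum (𝓞 ℚ) → ℕ) (comm) (κ : continuousCohomology 1 T'.toTopRep)
    (hκ : resSubgroup T'.toTopRep ((cyclotomicLevelsRat p S).level ⊥ r.1) 1 κ =
        (r.1.noncommProd (fun ℓ => ∑ j ∈ range (N ℓ), (j : Module.End ℤ_[p] (continuousCohomology 1
          (subgroupRep T'.toTopRep ((cyclotomicLevelsRat p S).level ⊥ r.1)))) *
          (conjMap T'.toTopRep ((cyclotomicLevelsRat p S).level ⊥ r.1) (σ ℓ) 1).hom.toLinearMap ^ j) comm)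
        (ContinuousCohomology.map (ContinuousMonoidHom.id _)
          (X := subgroupRep (W.tateGaloisRep p (W.continuous_galoisRepTate_holds p)).toTopRep
            ((cyclotomicLevelsRat p S).level ⊥ r.1))
          (Y := subgroupRep T'.toTopRep ((cyclotomicLevelsRat p S).level ⊥ r.1))
          ((TopRep.resFunctor ((cyclotomicLevelsRat p S).level ⊥ r.1).subtype).map red) 1 (c ⊥ r)))
    (w : HeightOneSpectrum (𝓞 ℚ)) (hw : ∀ q ∈ r.1, q ≠ w)
    (hordq : ∀ q ∈ r.1, ¬ p ∣ orderOf ((((primesEquiv w : Nat.Primes) : ℕ) :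
      ZMod ((primesEquiv q : Nat.Primes) : ℕ)))) :
    galoisCohomology.localization (W.torsionGaloisModule ((p : ℤ) ^ k * (p : ℤ))) (Sum.inr w) 1 (Φ κ) ∈
      propagatedSelmerStructure W p k (Sum.inr w) :=
  Rat.localization_mem_propagatedSelmerStructure_of_res_eq_deriv_of_not_dvd_orderOf W p k red e hec he
    hcomp Φ hΦ r σ N comm κ hκ w hw (not_dvd_orderOf_prod_of_forall Fact.out r.1 _ hordq)

end LocalClause

end Derivative

end Summit.BirchSwinnertonDyer.Rank1Residual.GaloisImage

end
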